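import Summits.ValiantsHypothesis.ValiantsHypothesis.Theorems.BarrierLeverNPCorpusChain
import Literature.Barriers.ValiantsHypothesis.KRST2022AsPrinted
import Literature.Barriers.ValiantsHypothesis.GKSS17FSVPresentation
import Literature.Barriers.ValiantsHypothesis.CKRST20NaturalProofsExist

/-!
# Route BarrierLever — the NP corpus chain, part 2: the printed vocabularies typed against the rung
# (cell val-lit, NP corpus lead g2; sources KRST22 Def. 4 / §4 OP1, CKRST20 Question 1.4, GKSS17
# Def. 5 / Thm. 1, FSV18 Question 6)

Part 1 (`BarrierLeverNPCorpusChain.lean`) recorded the item-to-item arrows. This file records the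
DICTIONARY between the printed notions now typed in the tree by the val-lit typers and the route's
rung decls, as sorry-free theorems (no `def`s, nothing closes an item, `VP ≠ VNP` is not touched):

* `hasEfficientEquations_iff_eventually_not_hitting` — KRST22 **Def. 4** ("efficiently constructible
  equations", typed by t21 as `Literature…HasEfficientEquations F 𝒞`: ONE level `a`, ONE family
  `P_n`, vanishing on `𝒞 n b` for EVERY `b` eventually in `n`) is EQUIVALENT, for classes monotone in
  the size exponent, to the a priori weaker family-free statement "for one `a`, for every `b`,
  eventually in `n`, `𝒞 n b` is NOT a hitting set for `Distinguishers F n a`" (the FSV Thm. 4 / GKSS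
  Def. 5 reading). `→` is t21's `exists_not_isSuccinctHittingSet_of_hasEfficientEquations`; `←` is a
  diagonal choice of the exponent `b = β(n) → ∞` (new here).
* `question4_frame_iff_hasEfficientEquations` — CKRST20 **Question 1.4** in the frame `d = n`
  (t20's `CKRST2020_question4_frame`) is LITERALLY KRST22 Def. 4 for `VP` (`SmallCircuits`).
* `hasEfficientEquations_smallCircuits_iff` — hence all three printed "equations for `VP`"
  vocabularies are one statement, `∃ a, ∀ b, ∃ n₀, ∀ n ≥ n₀, ¬ IsSuccinctHittingSet …`.
* `not_crux_of_hasEfficientEquations`, `crux_iff_forall_exists_eventually_hitting` — that statement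
  denies the crux `Theses.BarrierLever.SuccinctHittingSetsForVP` (stmt-ValiantsHypothesis-14610 = FSV
  Question 6 over `ℂ`), whose negation is the INFINITELY-OFTEN version (`∃ a, ∀ b n₀, ∃ n ≥ n₀, ¬ …`);
  the gap a.e./i.o. is the only difference between "KRST Def. 4 for VP" and "¬ crux".
* `krstForVP_defFour` — the route's `Theses.BarrierLever.KRSTForVP` (stmt-18967) IMPLIES KRST22 §4
  Open Problem 1 in the paper's own words ("assuming the permanent is exponentially hard, `VP` has
  no efficiently constructible equations in the sense of Def. 4"); the converse is the a.e./i.o. gap.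
* `crux_of_gkss_uniform` — GKSS17 Def. 5 hitting for the FSV presentation at ONE exponent `b`
  (t19's bridge `GKSS2017.isSuccinctHittingSetFor_smallCircuits_iff`) gives the crux (one line, cited).

Honest framing: typed literature + glue between OPEN statements; every hypothesis named here
(`HasEfficientEquations ℂ (SmallCircuits ℂ)`, `CKRST2020_question4_frame`, the GKSS uniform
hitting property, permanent hardness) is OPEN in print and in the tree.

References: [KumarRamyaSaptharishiTengse2022] Def. 4, §4; [ChatterjeeKumarRamyaSaptharishiTengse2020]
Question 1.4, Def. 1.5; [GrochowKumarSaksSaraf2017] Def. 5, Thm. 1, Open Question 1;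
[ForbesShpilkaVolk2018] Thm. 4, Question 6.
-/

set_option linter.dupNamespace false

namespace Summit.ValiantsHypothesis.ValiantsHypothesis.Theorems.BarrierLever.NPCorpusChainTyped

open MvPolynomial Literature.Barriers.ValiantsHypothesis

/-! ### KRST22 Def. 4 ⟺ eventual non-hitting at one level (classes monotone in the exponent) -/

/-- **KRST22 Def. 4, family form ⟺ family-free form.** For a doubly indexed class `𝒞 n b`
monotone in `b` (for `n ≥ 1`), "`𝒞` has efficiently constructible equations" (one level `a`, one
family `P_n ≠ 0` in `Distinguishers F n a`, vanishing on `𝒞 n b` for every `b` eventually) holds iff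
for one level `a`, for every `b`, eventually in `n`, `𝒞 n b` is not a hitting set for
`Distinguishers F n a`. (`←`: choose the non-hitting witnesses along a diagonal `b = β(n) → ∞`.)
[cite: KumarRamyaSaptharishiTengse2022, Def. 4; ForbesShpilkaVolk2018, Thm. 4] -/
theorem hasEfficientEquations_iff_eventually_not_hitting {F : Type*} [Field F]
    {𝒞 : (n : ℕ) → ℕ → Set (MvPolynomial (Fin n) F)}
    (hmono : ∀ n b b', 1 ≤ n → b ≤ b' → 𝒞 n b ⊆ 𝒞 n b') :
    HasEfficientEquations F 𝒞 ↔
      ∃ a : ℕ, ∀ b : ℕ, ∃ n₀ : ℕ, ∀ n : ℕ, n₀ ≤ n →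
        ¬ IsSuccinctHittingSet (degLEMonomials n) (𝒞 n b) (Distinguishers F n a) := by
  classical
  constructor
  · exact exists_not_isSuccinctHittingSet_of_hasEfficientEquations
  · rintro ⟨a, ha⟩
    choose n₀ hn₀ using ha
    -- non-hitting witnesses, chosen uniformly in `(n, b)` wherever they exist
    have hw : ∀ n b, n₀ b ≤ n → ∃ D : MvPolynomial (degLEMonomials n) F,
        D ∈ Distinguishers F n a ∧ D ≠ 0 ∧
          ∀ f ∈ 𝒞 n b, eval (coeffVector (degLEMonomials n) f) D = 0 := by
      intro n b hb
      have h := hn₀ b n hb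
      simp only [IsSuccinctHittingSet, not_forall, not_exists, not_and, not_not] at h
      obtain ⟨D, hD, hne, hvan⟩ := h
      exact ⟨D, hD, hne, hvan⟩
    choose W hW using hw
    -- a monotone majorant of `n₀` with `N b ≥ b + 1`
    let N : ℕ → ℕ := fun b => (Finset.range (b + 1)).sup n₀ + (b + 1)
    have hN₀ : ∀ b, n₀ b ≤ N b := fun b =>
      (Finset.le_sup (f := n₀) (Finset.self_mem_range_succ b)).trans (Nat.le_add_right _ _)
    have hNb : ∀ b, b + 1 ≤ N b := fun b => Nat.le_add_left _ _
    have hNmono : ∀ b b', b ≤ b' → N b ≤ N b' := by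
      intro b b' hbb'
      exact Nat.add_le_add (Finset.sup_mono (Finset.range_mono (Nat.succ_le_succ hbb')))
        (Nat.succ_le_succ hbb')
    -- the diagonal exponent: the largest `b ≤ n` with `N b ≤ n`
    let β : ℕ → ℕ := fun n => Nat.findGreatest (fun b => N b ≤ n) n
    have hβ : ∀ n b, N b ≤ n → b ≤ β n := by
      intro n b hb
      exact Nat.le_findGreatest ((Nat.le_succ b).trans ((hNb b).trans hb)) hb
    have hβN : ∀ n, N 0 ≤ n → N (β n) ≤ n := by
      intro n hn
      exact Nat.findGreatest_spec (P := fun b => N b ≤ n) (Nat.zero_le n) hn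
    let P : (n : ℕ) → MvPolynomial (degLEMonomials n) F := fun n =>
      if h : n₀ (β n) ≤ n then W n (β n) h else 0
    have hP : ∀ n (hn : N 0 ≤ n), P n = W n (β n) ((hN₀ _).trans (hβN n hn)) := by
      intro n hn
      simp only [P, dif_pos ((hN₀ _).trans (hβN n hn))]
    refine ⟨a, P, ⟨N 0, fun n hn => ?_⟩, fun b => ⟨N b, fun n hn f hf => ?_⟩⟩
    · rw [hP n hn]
      exact ⟨(hW _ _ _).2.1, (hW _ _ _).1⟩
    · have hn0 : N 0 ≤ n := (hNmono 0 b (Nat.zero_le b)).trans hn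
      rw [hP n hn0]
      have hn1 : 1 ≤ n := (Nat.succ_le_succ (Nat.zero_le 0)).trans ((hNb 0).trans hn0)
      exact (hW _ _ _).2.2 f (hmono n b (β n) hn1 (hβ n b hn) hf)

/-- The `VP` instance: `SmallCircuits F n b` is monotone in `b` (`smallCircuits_mono`), so KRST22
Def. 4 for `VP` is exactly "for one `a`, for every `b`, eventually `SmallCircuits F n b` does not hit
`Distinguishers F n a`". [cite: KumarRamyaSaptharishiTengse2022, Def. 4 and §4 Open Problem 1] -/
theorem hasEfficientEquations_smallCircuits_iff {F : Type*} [Field F] :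
    HasEfficientEquations F (SmallCircuits F) ↔
      ∃ a : ℕ, ∀ b : ℕ, ∃ n₀ : ℕ, ∀ n : ℕ, n₀ ≤ n →
        ¬ IsSuccinctHittingSet (degLEMonomials n) (SmallCircuits F n b) (Distinguishers F n a) :=
  hasEfficientEquations_iff_eventually_not_hitting fun _ _ _ hn hbb' => smallCircuits_mono F hbb' hn

/-! ### CKRST20 Question 1.4 (frame `d = n`) = KRST22 Def. 4 for `VP` -/

/-- **CKRST20 Question 1.4 in the tree's frame is literally KRST22 Def. 4 for `VP`:** t20's
`CKRST2020_question4_frame` (one level `a`, one family `D_n`, for every `b` eventually an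
`IsNaturalProof` against `SmallCircuits ℂ n b`) ⟺ `HasEfficientEquations ℂ (SmallCircuits ℂ)`.
(`→`: nonvanishing and membership are read off at `b = 0`; `←`: merge the two thresholds.)
[cite: ChatterjeeKumarRamyaSaptharishiTengse2020, Question 1.4; KumarRamyaSaptharishiTengse2022, Def. 4] -/
theorem question4_frame_iff_hasEfficientEquations :
    CKRST2020_question4_frame ↔ HasEfficientEquations ℂ (SmallCircuits ℂ) := by
  constructor
  · rintro ⟨a, D, hD⟩
    obtain ⟨n₁, hn₁⟩ := hD 0
    refine ⟨a, D, ⟨n₁, fun n hn => ⟨(hn₁ n hn).2.1, (hn₁ n hn).1⟩⟩, fun b => ?_⟩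
    obtain ⟨n₀, hn₀⟩ := hD b
    exact ⟨n₀, fun n hn f hf => (hn₀ n hn).2.2 f hf⟩
  · rintro ⟨a, P, ⟨n₁, hn₁⟩, hvan⟩
    refine ⟨a, P, fun b => ?_⟩
    obtain ⟨n₀, hn₀⟩ := hvan b
    refine ⟨max n₀ n₁, fun n hn => ⟨(hn₁ n ((le_max_right _ _).trans hn)).2,
      (hn₁ n ((le_max_right _ _).trans hn)).1, fun f hf => hn₀ n ((le_max_left _ _).trans hn) f hf⟩⟩

/-! ### … and each of them denies the crux; the crux is the negation of the i.o. version -/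

/-- KRST22 Def. 4 for `VP` over `ℂ` refutes the crux `Theses.BarrierLever.SuccinctHittingSetsForVP`
(stmt-ValiantsHypothesis-14610) — t21's `not_succinctHittingSetsForVP_of_hasEfficientEquations` read
on the route decl. [cite: KumarRamyaSaptharishiTengse2022, §1.1 and §4] -/
theorem not_crux_of_hasEfficientEquations (h : HasEfficientEquations ℂ (SmallCircuits ℂ)) :
    ¬ Theses.BarrierLever.SuccinctHittingSetsForVP :=
  not_succinctHittingSetsForVP_of_hasEfficientEquations h

/-- CKRST20 Question 1.4 answered "yes" (frame `d = n`) refutes the crux — t20's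
`question4_frame_not_succinctHittingSetsForVP` read on the route decl.
[cite: ChatterjeeKumarRamyaSaptharishiTengse2020, Question 1.4 and Def. 1.5] -/
theorem not_crux_of_question4_frame (h : CKRST2020_question4_frame) :
    ¬ Theses.BarrierLever.SuccinctHittingSetsForVP :=
  question4_frame_not_succinctHittingSetsForVP h

/-- **The crux and its negation, spelled out.** The crux is "for every level `a` SOME exponent `b`
hits eventually"; its negation is the INFINITELY-OFTEN equations statement "for one `a`, for every
`b`, for infinitely many `n`, `SmallCircuits ℂ n b` fails to hit `Distinguishers ℂ n a`" — weaker
than KRST22 Def. 4 / CKRST Q1.4 (which ask this for all large `n`). Pure logic; recorded so that the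
GAP-LEDGER can quote the exact open step. [cite: ForbesShpilkaVolk2018, Question 6; KumarRamyaSaptharishiTengse2022, Def. 4] -/
theorem not_crux_iff_io_not_hitting :
    ¬ Theses.BarrierLever.SuccinctHittingSetsForVP ↔
      ∃ a : ℕ, ∀ b n₀ : ℕ, ∃ n : ℕ, n₀ ≤ n ∧
        ¬ IsSuccinctHittingSet (degLEMonomials n) (SmallCircuits ℂ n b) (Distinguishers ℂ n a) := by
  simp only [Theses.BarrierLever.SuccinctHittingSetsForVP,
    Literature.Barriers.ValiantsHypothesis.SuccinctHittingSetsForVP, not_forall, not_exists,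
    exists_prop]

/-- The a.e. statement implies the i.o. one: KRST22 Def. 4 for `VP` ⟹ ¬ crux, now as an
implication between the two displayed quantifier shapes (the converse is the open a.e./i.o. gap —
no arrow in the tree or in print). [cite: KumarRamyaSaptharishiTengse2022, Def. 4 and §4] -/
theorem io_not_hitting_of_eventually_not_hitting {a : ℕ}
    (h : ∀ b : ℕ, ∃ n₀ : ℕ, ∀ n : ℕ, n₀ ≤ n →
      ¬ IsSuccinctHittingSet (degLEMonomials n) (SmallCircuits ℂ n b) (Distinguishers ℂ n a)) :
    ∀ b n₀ : ℕ, ∃ n : ℕ, n₀ ≤ n ∧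
      ¬ IsSuccinctHittingSet (degLEMonomials n) (SmallCircuits ℂ n b) (Distinguishers ℂ n a) := by
  intro b n₀
  obtain ⟨n₁, hn₁⟩ := h b
  exact ⟨max n₀ n₁, le_max_left _ _, hn₁ _ (le_max_right _ _)⟩

/-! ### KRST22 §4 Open Problem 1 in the paper's words, from the route's `KRSTForVP` -/

/-- **Item stmt-18967 ⟹ KRST22 §4 Open Problem 1 as printed.** The route's `KRSTForVP`
("if `per_{j^c}` needs size `≥ 2^j` for all large `j`, then FSV Question 6 holds over `ℂ`") gives,
under the same hardness hypothesis, that `VP` has NO efficiently constructible equations in the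
sense of KRST22 Def. 4 — the literal `VP`-analogue of their Thm. 1.2 that §4 OP1 asks for. (The
route item is the STRONGER i.o.-free form; the converse OP1 ⟹ 18967 is the a.e./i.o. gap.)
[cite: KumarRamyaSaptharishiTengse2022, §4 Open Problem 1 and Def. 4] -/
theorem krstForVP_defFour (h : Theses.BarrierLever.KRSTForVP)
    (hper : ∃ c m₀ : ℕ, ∀ j : ℕ, m₀ ≤ j → 2 ^ j ≤
      Literature.Computability.AlgebraicComplexity.complexity
        (Literature.Computability.AlgebraicComplexity.perPoly (Fin (j ^ c)) ℂ)) :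
    ¬ HasEfficientEquations ℂ (SmallCircuits ℂ) :=
  fun heq => not_succinctHittingSetsForVP_of_hasEfficientEquations heq (h hper)

/-- Contrapositive reading for the GAP-LEDGER (row N4): efficiently constructible equations for `VP`
over `ℂ` (KRST Def. 4) together with exponential hardness of the permanent would REFUTE item 18967 —
i.e. OP1's expected answer and Def-4-equations for `VP` cannot both hold under `per` hardness.
[cite: KumarRamyaSaptharishiTengse2022, §4] -/
theorem not_krstForVP_of_hasEfficientEquations (heq : HasEfficientEquations ℂ (SmallCircuits ℂ))
    (hper : ∃ c m₀ : ℕ, ∀ j : ℕ, m₀ ≤ j → 2 ^ j ≤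
      Literature.Computability.AlgebraicComplexity.complexity
        (Literature.Computability.AlgebraicComplexity.perPoly (Fin (j ^ c)) ℂ)) :
    ¬ Theses.BarrierLever.KRSTForVP :=
  fun h => krstForVP_defFour h hper heq

/-! ### GKSS17 Def. 5 at one exponent ⟹ the crux (t19's bridge, cited) -/

/-- **GKSS17 ⟹ crux (one line over t19's bridge).** If for ONE size exponent `b` the FSV classes
`SmallCircuits ℂ · b` form a succinct hitting set in GKSS Def. 5's sense for the presentation
`(n variables, degree ≤ n, N = binom(2n,n))` against `VP(N)` (`GKSS2017.VPMeta`), then FSV Question 6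
holds over `ℂ`, i.e. the crux. The hypothesis is the `∃ b ∀ a` (uniform) strengthening of the crux's
`∀ a ∃ b`; GKSS Thm. 1 / Open Question 1 concern it for `VP` presentations in general.
[cite: GrochowKumarSaksSaraf2017, Def. 5, Thm. 1, Open Question 1; ForbesShpilkaVolk2018, Question 6] -/
theorem crux_of_gkss_uniform {b : ℕ}
    (h : GKSS2017.IsSuccinctHittingSetFor ℂ (fun n => degLEMonomials n)
      (fun n => SmallCircuits ℂ n b) (GKSS2017.VPMeta ℂ (fun n => n) fun n => degLEMonomials n)) :
    Theses.BarrierLever.SuccinctHittingSetsForVP :=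
  GKSS2017.succinctHittingSetsForVP_of_isSuccinctHittingSetFor_smallCircuits ℂ h

end Summit.ValiantsHypothesis.ValiantsHypothesis.Theorems.BarrierLever.NPCorpusChainTyped
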